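import Literature.Computability.AlgebraicComplexity.BideterminantReduction
import Literature.Computability.AlgebraicComplexity.BideterminantReductionGauss
import Literature.Computability.AlgebraicComplexity.BideterminantReductionWeights

/-!
# Proof of Andrews–Forbes 2022, Proposition 3.5 (`AndrewsForbes2022_prop_3_5_holds`)

Discharges the named fact `AndrewsForbes2022_prop_3_5` of `BideterminantReduction.lean`
(R. Andrews, M. A. Forbes, *Ideals, determinants, and straightening*, STOC 2022 =
arXiv:2112.00792, Prop. 3.5, p. 21): for `𝔽` of characteristic zero, `1 ≤ r ≤ min(n,m)` and a
nonzero `f ∈ I^det_{n,m,r}`, an invertible linear change of the `nm` variables over `𝔽(ε)` turns `f`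
into `ε^q α (K_σ | K_σ)(X) + O(ε^{q+1})` with `α ≠ 0` and `σ₁ ≥ r`.

## The argument formalised here

The printed proof expands `f` in the standard bideterminant basis and tracks leading terms under
the row/column operators of Lemma 3.4 via the straightening law (Thms. 2.24–2.25, Cor. 2.26), then
separates shapes by the `(D+1)`-adic scaling `x_{i,j} ↦ y^{(D+1)^i} z^{(D+1)^j} x_{i,j}` and passes
to `ε` (Lemma "approximate leading coefficient"). Mathlib has no straightening law, so the shape
bookkeeping is replaced by highest-weight theory for `G = GL_n(𝔽) × GL_m(𝔽)` acting by
`f ↦ f(A X B)`; the scaling step and the passage to `ε` are kept as printed. Steps: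

1. (`exists_min_weight`) Let `b = deg f + 2` and weigh the monomial `X^e` by
   `⟨w,e⟩ = ∑_i μ_i b^i + ∑_j ν_j b^{n+j}` (`μ, ν` = row/column sums of `e`; `b`-adic digits, so
   `⟨w,e⟩` determines `(μ, ν)` on monomials of translates of `f`, `rowWt_eq_of_mem_support_init`).
   Let `q` be the least weight occurring in any translate `f(A X B)`, `A, B` invertible, attained by
   `e₀ ∈ supp f(A X B)`; put `f' = f(AXB)` and `h = ` the part of `f'` of weight `q`
   (`= coeff_q` of the torus family `twist w f'`).
2. (`transl_lower_init_eq`, `transl_upper_init_eq`) `h(L X U) = h(X)` for all unitriangular `L`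
   (lower) and `U` (upper) over `𝔽`: such a substitution moves every variable by terms of smaller
   weight, while every monomial of `h(LXU)` still occurs in a translate of `f` (it is a
   `t`-coefficient of a family whose values are translates), hence has weight `≥ q`.
3. (`init_mem_vanishIdeal`) `h` vanishes at every matrix `A' P₀ B'`, `P₀ = diag(1^{r-1}, 0)`,
   because the `r × r` minors do (rank), and this property passes to translates and `t`-coefficients.
4. (`rowWt_antitone`) `μ = rowWt e₀` is non-increasing: swapping two rows is a translate, and an
   increase would produce a smaller weight.
5. (`init_eq_C_mul_prodMinors`) Identification, replacing straightening: in the fraction field `𝕂`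
   of `𝔽[Ẑ]`, `Ẑ` the generic `(n+m) × (n+m)` matrix, Gauss elimination
   (`exists_lower_mul_mul_upper_eq_diagonal`) gives unitriangular `L̂, Û` with `L̂ Ẑ Û` diagonal;
   restricting to the `n × m` corner `X` and using Step 2 as a polynomial identity
   (`ev_lower_mul_mul_upper_eq_of_forall`) yields `h(X) = h(D̃) = c · ∏ δ_i^{μ_i}` with
   `c = h(diag(1,…,1)) ∈ 𝔽`, while `det X_{[k],[k]} = δ_0 ⋯ δ_{k-1}`; hence
   `h = c · ∏_k (det X_{[k],[k]})^{μ_{k-1} - μ_k} = c · (K_σ | K_σ)(X)`, `c ≠ 0`.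
6. (`exists_part_ge`) `σ₁ ≥ r` from Step 3 evaluated at `P₀`.
7. (`AndrewsForbes2022_prop_3_5_holds`) With `c_{(i,j),(k,l)} = A_{ik} B_{lj} ε^{w(k,l)}` one has
   `f(c · X) = ∑_e f'_e ε^{⟨w,e⟩} X^e = ε^q h + O(ε^{q+1})` coefficientwise.

## References

* [AndrewsForbes2022] R. Andrews, M. A. Forbes, STOC 2022 / arXiv:2112.00792, §3.1, Prop. 3.5
  (and Lemma 3.4, Cor. 2.26 for the roles replaced here).
* C. De Concini, D. Eisenbud, C. Procesi, Invent. Math. 56 (1980) — `U`-invariants of `𝔽[X]` are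
  generated by the leading principal minors (the classical fact behind Step 5). [folklore]
-/

noncomputable section

namespace Literature.Computability.AlgebraicComplexity

namespace AndrewsForbes

open MvPolynomial Matrix

variable {F : Type*} [Field F] {n m : ℕ}

/-! ### Step 0: the digit weight -/

/-- The digit weight `w(i,j) = b^i + b^{n+j}` on the variables `x_{i,j}` (so that
`⟨w, e⟩ = ∑ μ_i b^i + ∑ ν_j b^{n+j}` for the row/column sums `μ, ν` of `e`): the `(D+1)`-adic
separation of the printed proof with base `b = D + 2`. [cite: AndrewsForbes2022, §3.1 (proof of Prop. 3.5)] -/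
def dwt (n m b : ℕ) : Fin n × Fin m → ℕ := fun ij => b ^ (ij.1 : ℕ) + b ^ (n + (ij.2 : ℕ))

/-- `dwt` unfolded (it has the form `u_i + v_j` with `u_i = b^i`, `v_j = b^{n+j}`). [folklore] -/
theorem dwt_eq (b : ℕ) : dwt n m b = fun ij : Fin n × Fin m => b ^ (ij.1 : ℕ) + b ^ (n + (ij.2 : ℕ)) :=
  rfl

/-- The weight of a single variable. [folklore] -/
theorem weight_dwt_single (b : ℕ) (kl : Fin n × Fin m) :
    Finsupp.weight (dwt n m b) (Finsupp.single kl 1) = b ^ (kl.1 : ℕ) + b ^ (n + (kl.2 : ℕ)) := by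
  rw [Finsupp.weight_single, one_smul]
  rfl

/-! ### Step 3 (first half): the vanishing ideal of the rank-`< r` test matrices -/

/-- The `n × m` test matrix `P₀ = diag(1, …, 1, 0, …, 0)` with `k` ones. [folklore] -/
def rectOne (F : Type*) [Field F] (n m k : ℕ) : Matrix (Fin n) (Fin m) F :=
  Matrix.of fun i j => if (i : ℕ) = (j : ℕ) ∧ (i : ℕ) < k then 1 else 0

/-- The ideal of polynomials vanishing at every `A' · P₀ · B'` (`P₀ = rectOne k`, `A', B'` arbitrary
square matrices over `𝔽`), i.e. on all matrices factoring through rank `k` in this explicit way.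
[folklore] -/
def vanishIdeal (F : Type*) [Field F] (n m k : ℕ) : Ideal (MvPolynomial (Fin n × Fin m) F) :=
  ⨅ (A' : Matrix (Fin n) (Fin n) F), ⨅ (B' : Matrix (Fin m) (Fin m) F),
    RingHom.ker (ev (A' * rectOne F n m k * B'))

/-- Membership in `vanishIdeal`. [folklore] -/
theorem mem_vanishIdeal_iff {k : ℕ} {p : MvPolynomial (Fin n × Fin m) F} :
    p ∈ vanishIdeal F n m k ↔
      ∀ (A' : Matrix (Fin n) (Fin n) F) (B' : Matrix (Fin m) (Fin m) F),
        ev (A' * rectOne F n m k * B') p = 0 := by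
  simp only [vanishIdeal, Ideal.mem_iInf, RingHom.mem_ker]

/-- `rectOne k` factors through `𝔽^k`. [folklore] -/
theorem rectOne_eq_mul (k : ℕ) :
    rectOne F n m k =
      (Matrix.of fun (i : Fin n) (a : Fin k) => if (i : ℕ) = (a : ℕ) then (1 : F) else 0) *
        (Matrix.of fun (a : Fin k) (j : Fin m) => if (a : ℕ) = (j : ℕ) then (1 : F) else 0) := by
  ext i j
  simp only [rectOne, Matrix.of_apply, Matrix.mul_apply, ite_mul, one_mul, zero_mul]
  by_cases h : (i : ℕ) = (j : ℕ) ∧ (i : ℕ) < k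
  · rw [if_pos h, Finset.sum_eq_single ⟨i, h.2⟩]
    · simp [h.1]
    · intro a _ ha
      have : (i : ℕ) ≠ (a : ℕ) := fun h' => ha (Fin.ext h'.symm)
      simp [this]
    · intro h'
      exact absurd (Finset.mem_univ _) h'
  · rw [if_neg h]
    symm
    refine Finset.sum_eq_zero fun a _ => ?_
    by_cases hia : (i : ℕ) = (a : ℕ)
    · have hne : ¬ ((a : ℕ) = (j : ℕ)) := fun haj => h ⟨hia.trans haj, hia ▸ a.2⟩
      simp [hia, hne]
    · simp [hia]

/-- A square matrix factoring through a smaller space is singular. [folklore] -/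
theorem det_mul_eq_zero_of_lt {r k : ℕ} (hk : k < r) (E : Matrix (Fin r) (Fin k) F)
    (G : Matrix (Fin k) (Fin r) F) : (E * G).det = 0 := by
  by_contra h
  have hu : IsUnit (E * G) := (Matrix.isUnit_iff_isUnit_det _).mpr (Ne.isUnit h)
  have h1 := Matrix.rank_of_isUnit _ hu
  have h2 := Matrix.rank_mul_le_left E G
  have h3 := Matrix.rank_le_card_width E
  simp only [Fintype.card_fin] at h1 h3
  omega

/-- The `r × r` minors of `A' P₀ B'` vanish when `P₀` has `k < r` ones. [folklore] -/
theorem det_submatrix_rectOne_eq_zero {r k : ℕ} (hk : k < r) (A' : Matrix (Fin n) (Fin n) F)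
    (B' : Matrix (Fin m) (Fin m) F) (ρ : Fin r → Fin n) (γ : Fin r → Fin m) :
    ((A' * rectOne F n m k * B').submatrix ρ γ).det = 0 := by
  rw [rectOne_eq_mul, ← Matrix.mul_assoc, Matrix.mul_assoc,
    Matrix.submatrix_mul _ _ ρ id γ Function.bijective_id]
  exact det_mul_eq_zero_of_lt hk _ _

/-- `I^det_{n,m,r} ⊆ vanishIdeal k` for `k < r`. [folklore] -/
theorem detIdeal_le_vanishIdeal {r k : ℕ} (hk : k < r) : detIdeal F n m r ≤ vanishIdeal F n m k := by
  rw [detIdeal, Ideal.span_le]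
  rintro p ⟨ρ, γ, rfl⟩
  rw [SetLike.mem_coe, mem_vanishIdeal_iff]
  intro A' B'
  rw [ev_det_submatrix]
  exact det_submatrix_rectOne_eq_zero hk A' B' ρ γ

/-- Numerical matrices mapped by `algebraMap 𝔽 𝔽` are themselves. [folklore] -/
theorem map_algebraMap_self {ι κ : Type*} (A : Matrix ι κ F) : A.map (algebraMap F F) = A := by
  ext i j
  simp

/-- `vanishIdeal` is stable under translates. [folklore] -/
theorem transl_mem_vanishIdeal {k : ℕ} {p : MvPolynomial (Fin n × Fin m) F}
    (hp : p ∈ vanishIdeal F n m k) (A : Matrix (Fin n) (Fin n) F) (B : Matrix (Fin m) (Fin m) F) :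
    transl A B p ∈ vanishIdeal F n m k := by
  rw [mem_vanishIdeal_iff] at hp ⊢
  intro A' B'
  rw [ev_transl, map_algebraMap_self, map_algebraMap_self]
  have : A * (A' * rectOne F n m k * B') * B = (A * A') * rectOne F n m k * (B' * B) := by
    simp only [Matrix.mul_assoc]
  rw [this]
  exact hp _ _

/-- The coefficient functional `coeff e` as a linear map. [folklore] -/
def coeffL (e : Fin n × Fin m →₀ ℕ) : MvPolynomial (Fin n × Fin m) F →ₗ[F] F where
  toFun := coeff e
  map_add' := coeff_add e
  map_smul' c p := by simp only [coeff_smul, smul_eq_mul, RingHom.id_apply]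

/-- Unfolding `coeffL`. [folklore] -/
@[simp]
theorem coeffL_apply (e : Fin n × Fin m →₀ ℕ) (p : MvPolynomial (Fin n × Fin m) F) :
    coeffL e p = coeff e p := rfl

/-- `vanishIdeal` is stable under taking coefficients of the torus family (its values at
`t₀ ≠ 0` are translates). [folklore] -/
theorem coeff_twist_mem_vanishIdeal [Infinite F] {k : ℕ} {p : MvPolynomial (Fin n × Fin m) F}
    (hp : p ∈ vanishIdeal F n m k) (u : Fin n → ℕ) (v : Fin m → ℕ) (q : ℕ) :
    (twist (fun ij : Fin n × Fin m => u ij.1 + v ij.2) p).coeff q ∈ vanishIdeal F n m k := by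
  rw [mem_vanishIdeal_iff]
  intro A' B'
  have := apply_coeff_eq_zero_of_forall_eval (twist (fun ij : Fin n × Fin m => u ij.1 + v ij.2) p)
    ((ev (A' * rectOne F n m k * B') : MvPolynomial (Fin n × Fin m) F →ₐ[F] F).toLinearMap)
    (fun t₀ _ => ?_) q
  · simpa using this
  · rw [AlgHom.toLinearMap_apply, eval_twist]
    have h := transl_mem_vanishIdeal hp (diagonal fun i => t₀ ^ u i) (diagonal fun j => t₀ ^ v j)
    exact (mem_vanishIdeal_iff.mp h) A' B'

/-! ### Step 1: the minimal weight and the initial form -/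

/-- Translates by invertible matrices do not raise the total degree, so all row and column weights
of their monomials are `< deg f + 2`. [folklore] -/
theorem rowWt_lt_of_mem_support_transl (f : MvPolynomial (Fin n × Fin m) F)
    (A : Matrix (Fin n) (Fin n) F) (B : Matrix (Fin m) (Fin m) F) {e : Fin n × Fin m →₀ ℕ}
    (he : e ∈ (transl A B f).support) :
    (∀ i, rowWt e i < f.totalDegree + 2) ∧ (∀ j, colWt e j < f.totalDegree + 2) := by
  have hdeg : e.degree ≤ f.totalDegree := by
    refine le_trans ?_ (totalDegree_transl_le A B f)
    have := MvPolynomial.le_totalDegree he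
    rwa [Finsupp.degree_eq_sum, ← Finsupp.sum_fintype e (fun _ k => k) (by simp)]
  exact ⟨fun i => lt_of_le_of_lt ((rowWt_le_degree e i).trans hdeg) (by omega),
    fun j => lt_of_le_of_lt ((colWt_le_degree e j).trans hdeg) (by omega)⟩

/-- **Existence of the extremal datum.** For `f ≠ 0` there are a weight `q`, invertible `A, B`
and a monomial `e₀` of `f(AXB)` of digit weight `q` such that no monomial of any invertible
translate of `f` has smaller weight. [folklore] -/
theorem exists_min_weight (b : ℕ) {f : MvPolynomial (Fin n × Fin m) F} (hf : f ≠ 0) :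
    ∃ (q : ℕ) (A : Matrix (Fin n) (Fin n) F) (B : Matrix (Fin m) (Fin m) F) (e₀ : Fin n × Fin m →₀ ℕ),
      IsUnit A.det ∧ IsUnit B.det ∧ e₀ ∈ (transl A B f).support ∧
      Finsupp.weight (dwt n m b) e₀ = q ∧
      ∀ (A' : Matrix (Fin n) (Fin n) F) (B' : Matrix (Fin m) (Fin m) F), IsUnit A'.det → IsUnit B'.det →
        ∀ e ∈ (transl A' B' f).support, q ≤ Finsupp.weight (dwt n m b) e := by
  classical
  let P : ℕ → Prop := fun d => ∃ (A : Matrix (Fin n) (Fin n) F) (B : Matrix (Fin m) (Fin m) F)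
    (e : Fin n × Fin m →₀ ℕ), IsUnit A.det ∧ IsUnit B.det ∧ e ∈ (transl A B f).support ∧
      Finsupp.weight (dwt n m b) e = d
  have hP : ∃ d, P d := by
    obtain ⟨e, he⟩ := Finset.nonempty_iff_ne_empty.mpr (MvPolynomial.support_eq_empty.not.mpr hf)
    exact ⟨_, 1, 1, e, by simp, by simp, by simpa using he, rfl⟩
  refine ⟨Nat.find hP, ?_⟩
  obtain ⟨A, B, e₀, hA, hB, he₀, hw⟩ := Nat.find_spec hP
  refine ⟨A, B, e₀, hA, hB, he₀, hw, fun A' B' hA' hB' e he => ?_⟩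
  exact Nat.find_min' hP ⟨A', B', e, hA', hB', he, rfl⟩

section Extremal

/-! Throughout this section: `b ≥ 2` a base, `q` the minimal weight of `f` (hypothesis `hmin`),
`A, B` invertible, `f' = transl A B f`, and `h = coeff_q (twist w f')` its initial form. -/

variable {b q : ℕ} {f : MvPolynomial (Fin n × Fin m) F}
  {A : Matrix (Fin n) (Fin n) F} {B : Matrix (Fin m) (Fin m) F}

/-- Monomials of the initial form lie in the support of `f'` and have weight `q`. [folklore] -/
theorem mem_support_init {e : Fin n × Fin m →₀ ℕ}
    (he : e ∈ ((twist (dwt n m b) (transl A B f)).coeff q).support) :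
    e ∈ (transl A B f).support ∧ Finsupp.weight (dwt n m b) e = q :=
  mem_support_coeff_twist he

/-- All monomials of the initial form have the same row and column weights as `e₀` (digits).
[cite: AndrewsForbes2022, §3.1 (proof of Prop. 3.5, separation of multidegrees)] -/
theorem rowWt_eq_of_mem_support_init (hb : f.totalDegree + 2 ≤ b) {e₀ e : Fin n × Fin m →₀ ℕ}
    (he₀ : e₀ ∈ (transl A B f).support) (hw₀ : Finsupp.weight (dwt n m b) e₀ = q)
    (he : e ∈ ((twist (dwt n m b) (transl A B f)).coeff q).support) :
    rowWt e = rowWt e₀ ∧ colWt e = colWt e₀ := by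
  obtain ⟨he', hwe⟩ := mem_support_init he
  have hb0 : 0 < b := by omega
  obtain ⟨h1, h2⟩ := rowWt_lt_of_mem_support_transl f A B he'
  obtain ⟨h3, h4⟩ := rowWt_lt_of_mem_support_transl f A B he₀
  exact rowWt_eq_and_colWt_eq_of_weight_eq hb0 (fun i => (h1 i).trans_le hb) (fun j => (h2 j).trans_le hb)
    (fun i => (h3 i).trans_le hb) (fun j => (h4 j).trans_le hb) (hwe.trans hw₀.symm)

/-- The initial form is nonzero (it contains `e₀`). [folklore] -/
theorem init_ne_zero {e₀ : Fin n × Fin m →₀ ℕ} (he₀ : e₀ ∈ (transl A B f).support)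
    (hw₀ : Finsupp.weight (dwt n m b) e₀ = q) :
    (twist (dwt n m b) (transl A B f)).coeff q ≠ 0 := by
  intro h0
  have := coeff_coeff_twist (dwt n m b) (transl A B f) q e₀
  rw [h0, coeff_zero, if_pos hw₀] at this
  exact (mem_support_iff.mp he₀) this.symm

/-! ### Step 2: unipotent invariance of the initial form -/

/-- The row substitution `X ↦ L X` moves `x_{i,j}` by variables of smaller weight when `L` is
lower unitriangular. [folklore] -/
theorem transl_lower_X_sub_mem (hb : 2 ≤ b) (L : Matrix (Fin n) (Fin n) F)
    (hL : L.BlockTriangular OrderDual.toDual) (hLd : ∀ i, L i i = 1) (ij : Fin n × Fin m) :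
    transl L 1 (X ij) - X ij ∈ lowerPart F (dwt n m b) (dwt n m b ij) := by
  classical
  obtain ⟨i, j⟩ := ij
  have hX : transl L (1 : Matrix (Fin m) (Fin m) F) (X (i, j)) =
      ∑ k, C (L i k) * (X (k, j) : MvPolynomial (Fin n × Fin m) F) := by
    rw [transl_apply, ev_X, Matrix.map_one C (map_zero C) (map_one C), Matrix.mul_one]
    simp only [Matrix.mul_apply, Matrix.map_apply, mvPolynomialX_apply]
  have hXi : (X (i, j) : MvPolynomial (Fin n × Fin m) F) = C (L i i) * X (i, j) := by
    rw [hLd, C_1, one_mul]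
  rw [hX, hXi, ← Finset.sum_erase_eq_sub (Finset.mem_univ i)]
  refine Submodule.sum_mem _ fun k hk => ?_
  rw [Finset.mem_erase] at hk
  rcases lt_or_gt_of_ne hk.1 with hki | hik
  · rw [← smul_eq_C_mul]
    refine Submodule.smul_mem _ _ ?_
    rw [lowerPart, show (X (k, j) : MvPolynomial (Fin n × Fin m) F) = monomial (Finsupp.single (k, j) 1) 1
      from rfl, monomial_mem_restrictSupport]
    left
    simp only [Set.mem_setOf_eq, weight_dwt_single, dwt]
    have : b ^ (k : ℕ) < b ^ (i : ℕ) := Nat.pow_lt_pow_right (by omega) (Fin.lt_def.mp hki)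
    omega
  · rw [hL (show OrderDual.toDual k < OrderDual.toDual i from hik), C_0, zero_mul]
    exact Submodule.zero_mem _

/-- The column substitution `X ↦ X U` moves `x_{i,j}` by variables of smaller weight when `U` is
upper unitriangular. [folklore] -/
theorem transl_upper_X_sub_mem (hb : 2 ≤ b) (U : Matrix (Fin m) (Fin m) F)
    (hU : U.BlockTriangular id) (hUd : ∀ i, U i i = 1) (ij : Fin n × Fin m) :
    transl 1 U (X ij) - X ij ∈ lowerPart F (dwt n m b) (dwt n m b ij) := by
  classical
  obtain ⟨i, j⟩ := ij
  have hX : transl (1 : Matrix (Fin n) (Fin n) F) U (X (i, j)) =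
      ∑ l, (X (i, l) : MvPolynomial (Fin n × Fin m) F) * C (U l j) := by
    rw [transl_apply, ev_X, Matrix.map_one C (map_zero C) (map_one C), Matrix.one_mul]
    simp only [Matrix.mul_apply, Matrix.map_apply, mvPolynomialX_apply]
  have hXj : (X (i, j) : MvPolynomial (Fin n × Fin m) F) = X (i, j) * C (U j j) := by
    rw [hUd, C_1, mul_one]
  rw [hX, hXj, ← Finset.sum_erase_eq_sub (Finset.mem_univ j)]
  refine Submodule.sum_mem _ fun l hl => ?_
  rw [Finset.mem_erase] at hl
  rcases lt_or_gt_of_ne hl.1 with hlj | hjl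
  · rw [mul_comm, ← smul_eq_C_mul]
    refine Submodule.smul_mem _ _ ?_
    rw [lowerPart, show (X (i, l) : MvPolynomial (Fin n × Fin m) F) = monomial (Finsupp.single (i, l) 1) 1
      from rfl, monomial_mem_restrictSupport]
    left
    simp only [Set.mem_setOf_eq, weight_dwt_single, dwt]
    have : b ^ (n + (l : ℕ)) < b ^ (n + (j : ℕ)) :=
      Nat.pow_lt_pow_right (by omega) (by have := Fin.lt_def.mp hlj; omega)
    omega
  · rw [hU (show id j < id l from hjl), C_0, mul_zero]
    exact Submodule.zero_mem _

/-- Determinant of a lower unitriangular matrix. [folklore] -/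
theorem det_eq_one_of_lower (L : Matrix (Fin n) (Fin n) F) (hL : L.BlockTriangular OrderDual.toDual)
    (hLd : ∀ i, L i i = 1) : L.det = 1 := by
  rw [Matrix.det_of_lowerTriangular L hL]
  simp [hLd]

/-- Determinant of an upper unitriangular matrix. [folklore] -/
theorem det_eq_one_of_upper (U : Matrix (Fin m) (Fin m) F) (hU : U.BlockTriangular id)
    (hUd : ∀ i, U i i = 1) : U.det = 1 := by
  rw [Matrix.det_of_upperTriangular hU]
  simp [hUd]

/-- Diagonal matrices of powers of a nonzero scalar are invertible. [folklore] -/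
theorem isUnit_det_diagonal_pow {ι : Type*} [Fintype ι] [DecidableEq ι] {t₀ : F} (ht₀ : t₀ ≠ 0)
    (u : ι → ℕ) : IsUnit (diagonal fun i => t₀ ^ u i).det := by
  rw [det_diagonal]
  exact isUnit_iff_ne_zero.mpr (Finset.prod_ne_zero_iff.mpr fun i _ => pow_ne_zero _ ht₀)

/-- **Weights of translates of the initial form stay `≥ q`.** For any numerical `L, U` with unit
determinant... more precisely for any invertible `A₁, B₁`: every monomial of
`(transl A₁ B₁ h)` has weight `≥ q` — because `transl A₁ B₁ h` is the `t^q`-coefficient of a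
family whose value at `t₀ ≠ 0` is the translate of `f` by `(A · diag(t₀^u) · A₁, B₁ · diag(t₀^v) · B)`.
[folklore] -/
theorem le_weight_of_mem_support_transl_init [Infinite F]
    (hmin : ∀ (A' : Matrix (Fin n) (Fin n) F) (B' : Matrix (Fin m) (Fin m) F),
      IsUnit A'.det → IsUnit B'.det →
      ∀ e ∈ (transl A' B' f).support, q ≤ Finsupp.weight (dwt n m b) e)
    (hA : IsUnit A.det) (hB : IsUnit B.det)
    (A₁ : Matrix (Fin n) (Fin n) F) (B₁ : Matrix (Fin m) (Fin m) F) (hA₁ : IsUnit A₁.det)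
    (hB₁ : IsUnit B₁.det) {e : Fin n × Fin m →₀ ℕ}
    (he : e ∈ (transl A₁ B₁ ((twist (dwt n m b) (transl A B f)).coeff q)).support) :
    q ≤ Finsupp.weight (dwt n m b) e := by
  by_contra hlt
  push Not at hlt
  set w := dwt n m b with hw
  set P := (twist w (transl A B f)).map
    (transl A₁ B₁ : MvPolynomial (Fin n × Fin m) F →+* MvPolynomial (Fin n × Fin m) F) with hP
  have hcoeff : P.coeff q = transl A₁ B₁ ((twist w (transl A B f)).coeff q) := by
    rw [hP, Polynomial.coeff_map]
    rfl
  have hzero := apply_coeff_eq_zero_of_forall_eval P (coeffL e) (fun t₀ ht₀ => ?_) q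
  · rw [coeffL_apply, hcoeff] at hzero
    exact (mem_support_iff.mp he) hzero
  · rw [coeffL_apply, hP, eval_map_twist, hw, dwt_eq,
      eval_twist (fun i : Fin n => b ^ (i : ℕ)) (fun j : Fin m => b ^ (n + (j : ℕ))),
      transl_transl, transl_transl]
    by_contra hne
    have hmem := MvPolynomial.mem_support_iff.mpr hne
    have h1 : IsUnit (A * ((diagonal fun i : Fin n => t₀ ^ (b ^ (i : ℕ))) * A₁)).det := by
      rw [det_mul, det_mul]
      exact hA.mul ((isUnit_det_diagonal_pow ht₀ (fun i : Fin n => b ^ (i : ℕ))).mul hA₁)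
    have h2 : IsUnit ((B₁ * diagonal fun j : Fin m => t₀ ^ (b ^ (n + (j : ℕ)))) * B).det := by
      rw [det_mul, det_mul]
      exact (hB₁.mul (isUnit_det_diagonal_pow ht₀ (fun j : Fin m => b ^ (n + (j : ℕ))))).mul hB
    exact absurd (hmin _ _ h1 h2 e hmem) (not_le.mpr hlt)

/-- **Invariance under lower unitriangular row operations.** [folklore] -/
theorem transl_lower_init_eq [Infinite F] (hb : 2 ≤ b)
    (hmin : ∀ (A' : Matrix (Fin n) (Fin n) F) (B' : Matrix (Fin m) (Fin m) F),
      IsUnit A'.det → IsUnit B'.det →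
      ∀ e ∈ (transl A' B' f).support, q ≤ Finsupp.weight (dwt n m b) e)
    (hA : IsUnit A.det) (hB : IsUnit B.det)
    (L : Matrix (Fin n) (Fin n) F) (hL : L.BlockTriangular OrderDual.toDual) (hLd : ∀ i, L i i = 1) :
    transl L 1 ((twist (dwt n m b) (transl A B f)).coeff q) =
      (twist (dwt n m b) (transl A B f)).coeff q := by
  refine eq_of_filtered (transl L 1) (transl_lower_X_sub_mem hb L hL hLd) _
    (fun e he => (mem_support_init he).2) fun e he => ?_
  refine le_weight_of_mem_support_transl_init hmin hA hB L 1 ?_ (by simp) he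
  rw [det_eq_one_of_lower L hL hLd]
  exact isUnit_one

/-- **Invariance under upper unitriangular column operations.** [folklore] -/
theorem transl_upper_init_eq [Infinite F] (hb : 2 ≤ b)
    (hmin : ∀ (A' : Matrix (Fin n) (Fin n) F) (B' : Matrix (Fin m) (Fin m) F),
      IsUnit A'.det → IsUnit B'.det →
      ∀ e ∈ (transl A' B' f).support, q ≤ Finsupp.weight (dwt n m b) e)
    (hA : IsUnit A.det) (hB : IsUnit B.det)
    (U : Matrix (Fin m) (Fin m) F) (hU : U.BlockTriangular id) (hUd : ∀ i, U i i = 1) :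
    transl 1 U ((twist (dwt n m b) (transl A B f)).coeff q) =
      (twist (dwt n m b) (transl A B f)).coeff q := by
  refine eq_of_filtered (transl 1 U) (transl_upper_X_sub_mem hb U hU hUd) _
    (fun e he => (mem_support_init he).2) fun e he => ?_
  refine le_weight_of_mem_support_transl_init hmin hA hB 1 U (by simp) ?_ he
  rw [det_eq_one_of_upper U hU hUd]
  exact isUnit_one

/-- **Two-sided unitriangular invariance** `h(L X U) = h(X)` at `𝔽`-points, in the form consumed by
`ev_lower_mul_mul_upper_eq_of_forall`. [folklore] -/
theorem ev_lower_upper_init_eq [Infinite F] (hb : 2 ≤ b)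
    (hmin : ∀ (A' : Matrix (Fin n) (Fin n) F) (B' : Matrix (Fin m) (Fin m) F),
      IsUnit A'.det → IsUnit B'.det →
      ∀ e ∈ (transl A' B' f).support, q ≤ Finsupp.weight (dwt n m b) e)
    (hA : IsUnit A.det) (hB : IsUnit B.det)
    (L : Matrix (Fin n) (Fin n) F) (U : Matrix (Fin m) (Fin m) F)
    (hL : L.BlockTriangular OrderDual.toDual) (hLd : ∀ i, L i i = 1)
    (hU : U.BlockTriangular id) (hUd : ∀ i, U i i = 1) :
    ev ((L.map C : Matrix (Fin n) (Fin n) (MvPolynomial (Fin n × Fin m) F)) *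
        mvPolynomialX (Fin n) (Fin m) F *
        (U.map C : Matrix (Fin m) (Fin m) (MvPolynomial (Fin n × Fin m) F)))
      ((twist (dwt n m b) (transl A B f)).coeff q) =
      (twist (dwt n m b) (transl A B f)).coeff q := by
  change transl L U _ = _
  have : transl L U ((twist (dwt n m b) (transl A B f)).coeff q) =
      transl L 1 (transl 1 U ((twist (dwt n m b) (transl A B f)).coeff q)) := by
    rw [transl_transl, Matrix.one_mul, Matrix.one_mul]
  rw [this, transl_upper_init_eq hb hmin hA hB U hU hUd, transl_lower_init_eq hb hmin hA hB L hL hLd]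

/-! ### Step 3 (second half): the initial form vanishes on the test matrices -/

/-- `h ∈ vanishIdeal k` for `k < r` when `f ∈ I^det_{n,m,r}`. [folklore] -/
theorem init_mem_vanishIdeal [Infinite F] {r k : ℕ} (hk : k < r) (hf : f ∈ detIdeal F n m r) :
    (twist (dwt n m b) (transl A B f)).coeff q ∈ vanishIdeal F n m k := by
  rw [dwt_eq]
  exact coeff_twist_mem_vanishIdeal (transl_mem_vanishIdeal (detIdeal_le_vanishIdeal hk hf) A B)
    (fun i : Fin n => b ^ (i : ℕ)) (fun j : Fin m => b ^ (n + (j : ℕ))) q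

/-! ### Step 4: dominance of the row weight -/

/-- Row permutations act on exponents by permuting row weights. [folklore] -/
theorem rowWt_mapDomain_perm (τ : Equiv.Perm (Fin n)) (e : Fin n × Fin m →₀ ℕ) (a : Fin n) :
    rowWt (Finsupp.mapDomain (fun ij : Fin n × Fin m => (τ ij.1, ij.2)) e) (τ a) = rowWt e a := by
  simp only [rowWt]
  refine Finset.sum_congr rfl fun j _ => ?_
  have hinj : Function.Injective (fun ij : Fin n × Fin m => (τ ij.1, ij.2)) := by
    intro x y hxy
    simp only [Prod.mk.injEq] at hxy
    exact Prod.ext (τ.injective hxy.1) hxy.2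
  exact Finsupp.mapDomain_apply hinj e (a, j)

/-- Row permutations do not change column weights. [folklore] -/
theorem colWt_mapDomain_perm (τ : Equiv.Perm (Fin n)) (e : Fin n × Fin m →₀ ℕ) :
    colWt (Finsupp.mapDomain (fun ij : Fin n × Fin m => (τ ij.1, ij.2)) e) = colWt e := by
  funext j
  simp only [colWt]
  have hinj : Function.Injective (fun ij : Fin n × Fin m => (τ ij.1, ij.2)) := by
    intro x y hxy
    simp only [Prod.mk.injEq] at hxy
    exact Prod.ext (τ.injective hxy.1) hxy.2
  calc ∑ i, (Finsupp.mapDomain (fun ij : Fin n × Fin m => (τ ij.1, ij.2)) e) (i, j)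
      = ∑ i, (Finsupp.mapDomain (fun ij : Fin n × Fin m => (τ ij.1, ij.2)) e) (τ i, j) :=
        (Equiv.sum_comp τ (fun i => (Finsupp.mapDomain (fun ij : Fin n × Fin m => (τ ij.1, ij.2)) e) (i, j))).symm
    _ = ∑ i, e (i, j) := Finset.sum_congr rfl fun i _ => Finsupp.mapDomain_apply hinj e (i, j)

/-- The translate by a permutation matrix is a renaming of the variables. [folklore] -/
theorem transl_permMatrix (τ : Equiv.Perm (Fin n)) (p : MvPolynomial (Fin n × Fin m) F) :
    transl (τ.permMatrix F) 1 p = rename (fun ij : Fin n × Fin m => (τ ij.1, ij.2)) p := by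
  have : transl (τ.permMatrix F) (1 : Matrix (Fin m) (Fin m) F) =
      rename (fun ij : Fin n × Fin m => (τ ij.1, ij.2)) := by
    refine MvPolynomial.algHom_ext fun ij => ?_
    obtain ⟨i, j⟩ := ij
    rw [rename_X, transl_apply, ev_X, Matrix.map_one C (map_zero C) (map_one C), Matrix.mul_one]
    simp only [Matrix.mul_apply, Matrix.map_apply, mvPolynomialX_apply, Equiv.Perm.permMatrix,
      PEquiv.toMatrix_apply, Equiv.toPEquiv_apply, Option.mem_def, Option.some.injEq]
    rw [Finset.sum_eq_single (τ i)]
    · simp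
    · intro k _ hk
      rw [if_neg (Ne.symm hk), map_zero, zero_mul]
    · intro h
      exact absurd (Finset.mem_univ _) h
  rw [this]

/-- A rearrangement inequality for two digits. [folklore] -/
theorem digit_swap_lt {μ μ' x y : ℕ} (hμ : μ < μ') (hxy : x < y) : μ' * x + μ * y < μ * x + μ' * y := by
  obtain ⟨d, rfl⟩ := Nat.exists_eq_add_of_lt hμ
  have : (d + 1) * x < (d + 1) * y := Nat.mul_lt_mul_of_pos_left hxy (Nat.succ_pos d)
  nlinarith

/-- **Dominance.** The row weight `μ = rowWt e₀` of the extremal monomial is non-increasing: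
otherwise swapping two rows (a translate) produces a monomial of smaller digit weight.
[folklore] -/
theorem rowWt_antitone (hb : 2 ≤ b)
    (hmin : ∀ (A' : Matrix (Fin n) (Fin n) F) (B' : Matrix (Fin m) (Fin m) F),
      IsUnit A'.det → IsUnit B'.det →
      ∀ e ∈ (transl A' B' f).support, q ≤ Finsupp.weight (dwt n m b) e)
    (hA : IsUnit A.det) (hB : IsUnit B.det) {e₀ : Fin n × Fin m →₀ ℕ}
    (he₀ : e₀ ∈ (transl A B f).support) (hw₀ : Finsupp.weight (dwt n m b) e₀ = q)
    {i i' : Fin n} (hii' : i < i') : rowWt e₀ i' ≤ rowWt e₀ i := by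
  classical
  by_contra hlt
  push Not at hlt
  let τ : Equiv.Perm (Fin n) := Equiv.swap i i'
  let g : Fin n × Fin m → Fin n × Fin m := fun ij => (τ ij.1, ij.2)
  have hinj : Function.Injective g := by
    intro x y hxy
    simp only [g, Prod.mk.injEq] at hxy
    exact Prod.ext (τ.injective hxy.1) hxy.2
  let e₁ := Finsupp.mapDomain g e₀
  -- `e₁` occurs in a translate
  have hmem : e₁ ∈ (transl (A * τ.permMatrix F) (1 * B) f).support := by
    rw [← transl_transl, transl_permMatrix, support_rename_of_injective hinj]
    exact Finset.mem_image_of_mem _ he₀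
  have hτ : IsUnit (A * τ.permMatrix F).det := by
    rw [det_mul, det_permutation]
    refine hA.mul ?_
    rcases Int.units_eq_one_or (Equiv.Perm.sign τ) with h | h <;> simp [h]
  have hq := hmin _ _ hτ (by simpa using hB) e₁ hmem
  -- but its weight is smaller
  have hrow : ∀ a, rowWt e₁ a = rowWt e₀ (τ a) := by
    intro a
    have := rowWt_mapDomain_perm τ e₀ (τ a)
    simp only [τ, Equiv.swap_apply_self] at this
    simpa [e₁, g, τ] using this
  have hcol : colWt e₁ = colWt e₀ := colWt_mapDomain_perm τ e₀
  have hwt : ∀ e : Fin n × Fin m →₀ ℕ, Finsupp.weight (dwt n m b) e =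
      ∑ a, rowWt e a * b ^ (a : ℕ) + ∑ j, colWt e j * b ^ (n + (j : ℕ)) := fun e => by
    rw [dwt_eq, weight_add_eq (fun i : Fin n => b ^ (i : ℕ)) (fun j : Fin m => b ^ (n + (j : ℕ))) e]
  have hsplit : ∀ φ : Fin n → ℕ, ∑ a, φ a = φ i + (φ i' + ∑ a ∈ (Finset.univ.erase i).erase i', φ a) := by
    intro φ
    rw [Finset.add_sum_erase _ _ (Finset.mem_erase.mpr ⟨hii'.ne', Finset.mem_univ _⟩),
      Finset.add_sum_erase _ _ (Finset.mem_univ _)]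
  have hrest : ∑ a ∈ (Finset.univ.erase i).erase i', rowWt e₁ a * b ^ (a : ℕ) =
      ∑ a ∈ (Finset.univ.erase i).erase i', rowWt e₀ a * b ^ (a : ℕ) := by
    refine Finset.sum_congr rfl fun a ha => ?_
    simp only [Finset.mem_erase] at ha
    rw [hrow a]
    simp [τ, Equiv.swap_apply_of_ne_of_ne ha.2.1 ha.1]
  have hlt' : Finsupp.weight (dwt n m b) e₁ < Finsupp.weight (dwt n m b) e₀ := by
    rw [hwt, hwt, hcol, hsplit (fun a => rowWt e₁ a * b ^ (a : ℕ)),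
      hsplit (fun a => rowWt e₀ a * b ^ (a : ℕ)), hrest, hrow i, hrow i']
    simp only [τ, Equiv.swap_apply_left, Equiv.swap_apply_right]
    have hpow : b ^ (i : ℕ) < b ^ (i' : ℕ) := Nat.pow_lt_pow_right (by omega) (Fin.lt_def.mp hii')
    have := digit_swap_lt hlt hpow
    omega
  rw [hw₀] at hlt'
  exact absurd hq (not_le.mpr hlt')

end Extremal

/-! ### Step 5: identification of the initial form with `c · (K_σ | K_σ)(X)` -/

section Identification

/-- The generic square matrix has nonzero leading principal minors (evaluate at `1`). [folklore] -/
theorem det_corner_mvPolynomialX_ne_zero {s k : ℕ} (hk : k ≤ s) :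
    ((mvPolynomialX (Fin s) (Fin s) F).submatrix (Fin.castLE hk) (Fin.castLE hk)).det ≠ 0 := by
  intro h0
  have := congrArg (ev (F := F) (1 : Matrix (Fin s) (Fin s) F)) h0
  rw [ev_det_submatrix, submatrix_one _ (Fin.castLE_injective hk), det_one, map_zero] at this
  exact one_ne_zero this

/-- The row weight of `e`, extended by zero to all natural indices. [folklore] -/
def rowWt' (e : Fin n × Fin m →₀ ℕ) (i : ℕ) : ℕ := if h : i < n then rowWt e ⟨i, h⟩ else 0

/-- `rowWt'` below `n`. [folklore] -/
theorem rowWt'_of_lt (e : Fin n × Fin m →₀ ℕ) {i : ℕ} (hi : i < n) : rowWt' e i = rowWt e ⟨i, hi⟩ := by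
  rw [rowWt', dif_pos hi]

/-- `rowWt'` from `n` on. [folklore] -/
theorem rowWt'_of_le (e : Fin n × Fin m →₀ ℕ) {i : ℕ} (hi : n ≤ i) : rowWt' e i = 0 := by
  rw [rowWt', dif_neg (not_lt.mpr hi)]

/-- A telescoping product: `∏_{k<p} (g_0 ⋯ g_k)^{μ_k - μ_{k+1}} = ∏_{i<p} g_i^{μ_i - μ_p}` for
non-increasing `μ`. [folklore] -/
theorem prod_pow_sub_telescope {M : Type*} [CommMonoid M] (g : ℕ → M) (μ : ℕ → ℕ)
    (hμ : ∀ i, μ (i + 1) ≤ μ i) : ∀ p : ℕ,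
    ∏ k ∈ Finset.range p, (∏ i ∈ Finset.range (k + 1), g i) ^ (μ k - μ (k + 1)) =
      ∏ i ∈ Finset.range p, g i ^ (μ i - μ p)
  | 0 => by simp
  | p + 1 => by
    have hanti : Antitone μ := antitone_nat_of_succ_le hμ
    rw [Finset.prod_range_succ, prod_pow_sub_telescope g μ hμ p, Finset.prod_range_succ,
      mul_pow, ← Finset.prod_pow, Finset.prod_range_succ, ← mul_assoc, ← Finset.prod_mul_distrib]
    congr 1
    refine Finset.prod_congr rfl fun i hi => ?_
    rw [← pow_add]
    congr 1
    have h1 : μ p ≤ μ i := hanti (Finset.mem_range.mp hi).le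
    have h2 : μ (p + 1) ≤ μ p := hμ p
    omega

/-- The bideterminant of the multiset `∑_k e_k • {k+1}` is `∏_k (det X_{[k+1],[k+1]})^{e_k}`. [folklore] -/
theorem kBideterminant_sum_replicate (ex : ℕ → ℕ) (p : ℕ) :
    kBideterminant F n m (∑ k ∈ Finset.range p, Multiset.replicate (ex k) (k + 1)) =
      ∏ k ∈ Finset.range p, leadingMinor F n m (k + 1) ^ ex k := by
  induction p with
  | zero => simp [kBideterminant]
  | succ p ih =>
    rw [Finset.sum_range_succ, Finset.prod_range_succ, kBideterminant, Multiset.map_add,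
      Multiset.prod_add, ← kBideterminant, ih, Multiset.map_replicate, Multiset.prod_replicate]

variable {b q : ℕ} {f : MvPolynomial (Fin n × Fin m) F}
  {A : Matrix (Fin n) (Fin n) F} {B : Matrix (Fin m) (Fin m) F}

/-- **Identification of the initial form** (the replacement for the straightening-law bookkeeping
of Lemma 3.4 / Prop. 3.5): the initial form `h` equals `c · ∏_k (det X_{[k+1],[k+1]})^{μ_k - μ_{k+1}}`
with `c = h(diag(1,…,1)) ≠ 0` and `μ` the (non-increasing, eventually zero) row weight of `e₀`.
[cite: AndrewsForbes2022, Prop. 3.5 (with Lemma 3.4)] -/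
theorem init_eq_C_mul_prod [CharZero F] (hb : 2 ≤ b) (hbf : f.totalDegree + 2 ≤ b)
    (hmin : ∀ (A' : Matrix (Fin n) (Fin n) F) (B' : Matrix (Fin m) (Fin m) F),
      IsUnit A'.det → IsUnit B'.det →
      ∀ e ∈ (transl A' B' f).support, q ≤ Finsupp.weight (dwt n m b) e)
    (hA : IsUnit A.det) (hB : IsUnit B.det) {e₀ : Fin n × Fin m →₀ ℕ}
    (he₀ : e₀ ∈ (transl A B f).support) (hw₀ : Finsupp.weight (dwt n m b) e₀ = q) :
    ∃ c : F, c ≠ 0 ∧ (∀ i, min n m ≤ i → rowWt' e₀ i = 0) ∧ (∀ i, rowWt' e₀ (i + 1) ≤ rowWt' e₀ i) ∧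
      (twist (dwt n m b) (transl A B f)).coeff q =
        C c * ∏ k ∈ Finset.range (min n m),
          leadingMinor F n m (k + 1) ^ (rowWt' e₀ k - rowWt' e₀ (k + 1)) := by
  classical
  set h := (twist (dwt n m b) (transl A B f)).coeff q with hhdef
  have hh0 : h ≠ 0 := init_ne_zero he₀ hw₀
  have hrow : ∀ e ∈ h.support, rowWt e = rowWt e₀ := fun e he =>
    (rowWt_eq_of_mem_support_init hbf he₀ hw₀ he).1
  have hinvF := ev_lower_upper_init_eq hb hmin hA hB (f := f) (q := q)
  have hanti : ∀ i i' : Fin n, i < i' → rowWt e₀ i' ≤ rowWt e₀ i := fun i i' hii' =>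
    rowWt_antitone hb hmin hA hB he₀ hw₀ hii'
  -- the numerical diagonal test matrix and `c`
  let D1F : Matrix (Fin n) (Fin m) F := Matrix.of fun i j => if (i : ℕ) = (j : ℕ) then 1 else 0
  set c : F := ev D1F h with hcdef
  -- the big fraction field
  set s := n + m with hsdef
  have hn : n ≤ s := Nat.le_add_right n m
  have hm : m ≤ s := Nat.le_add_left m n
  let Rb := MvPolynomial (Fin s × Fin s) F
  let 𝕂 := FractionRing Rb
  have hinjR : Function.Injective (algebraMap Rb 𝕂) := IsFractionRing.injective Rb 𝕂
  let Zh : Matrix (Fin s) (Fin s) 𝕂 := (mvPolynomialX (Fin s) (Fin s) F).map (algebraMap Rb 𝕂)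
  have hZ : ∀ k (hk : k ≤ s), (Zh.submatrix (Fin.castLE hk) (Fin.castLE hk)).det ≠ 0 := by
    intro k hk
    rw [Matrix.submatrix_map, ← RingHom.mapMatrix_apply, ← RingHom.map_det,
      map_ne_zero_iff _ hinjR]
    exact det_corner_mvPolynomialX_ne_zero hk
  obtain ⟨Lh, Uh, δ, hLt, hLd, hUt, hUd, hLZU⟩ := exists_lower_mul_mul_upper_eq_diagonal s Zh hZ
  let L : Matrix (Fin n) (Fin n) 𝕂 := Lh.submatrix (Fin.castLE hn) (Fin.castLE hn)
  let U : Matrix (Fin m) (Fin m) 𝕂 := Uh.submatrix (Fin.castLE hm) (Fin.castLE hm)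
  have hL' : L.BlockTriangular OrderDual.toDual := fun i j hij =>
    hLt (show OrderDual.toDual (Fin.castLE hn j) < OrderDual.toDual (Fin.castLE hn i) from
      OrderDual.toDual_lt_toDual.mpr
        (Fin.lt_def.mpr (Fin.lt_def.mp (OrderDual.toDual_lt_toDual.mp hij))))
  have hLd' : ∀ i, L i i = 1 := fun i => hLd _
  have hU' : U.BlockTriangular id := fun i j hij =>
    hUt (show id (Fin.castLE hm j) < id (Fin.castLE hm i) from Fin.lt_def.mpr (Fin.lt_def.mp hij))
  have hUd' : ∀ i, U i i = 1 := fun i => hUd _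
  -- the generic `n × m` corner and the evaluation at it (an injection `𝔽[X] → 𝕂`)
  let Xm : Matrix (Fin n) (Fin m) 𝕂 := Zh.submatrix (Fin.castLE hn) (Fin.castLE hm)
  let emb : Fin n × Fin m → Fin s × Fin s := fun ij => (Fin.castLE hn ij.1, Fin.castLE hm ij.2)
  have hemb : Function.Injective emb := by
    intro x y hxy
    simp only [emb, Prod.mk.injEq] at hxy
    exact Prod.ext (Fin.castLE_injective hn hxy.1) (Fin.castLE_injective hm hxy.2)
  have hevXm : (ev Xm : MvPolynomial (Fin n × Fin m) F →ₐ[F] 𝕂) =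
      (IsScalarTower.toAlgHom F Rb 𝕂).comp (rename emb) := by
    refine MvPolynomial.algHom_ext fun ij => ?_
    rw [ev_X, AlgHom.comp_apply, rename_X, IsScalarTower.coe_toAlgHom']
    simp [Xm, Zh, emb]
  have hinj : Function.Injective (ev Xm : MvPolynomial (Fin n × Fin m) F →ₐ[F] 𝕂) := by
    rw [hevXm, AlgHom.coe_comp]
    exact hinjR.comp (rename_injective emb hemb)
  -- Gauss: `L · Xm · U` is the corner of a diagonal matrix
  have hcorner : L * Xm * U = (diagonal δ).submatrix (Fin.castLE hn) (Fin.castLE hm) := by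
    rw [← hLZU]
    exact (submatrix_mul_mul_castLE Lh Zh Uh hLt hUt hn hm).symm
  let a : Fin n → 𝕂 := fun i => δ (Fin.castLE hn i)
  let D1 : Matrix (Fin n) (Fin m) 𝕂 := Matrix.of fun i j => if (i : ℕ) = (j : ℕ) then 1 else 0
  have hD : (diagonal δ).submatrix (Fin.castLE hn) (Fin.castLE hm) =
      Matrix.of fun i j => a i * D1 i j := by
    rw [corner_diagonal]
    ext i j
    simp only [Matrix.of_apply, D1, a, mul_ite, mul_one, mul_zero]
  -- invariance transported to `𝕂`, then scaling
  have hinvK : ev (L * Xm * U) h = ev Xm h :=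
    ev_lower_mul_mul_upper_eq_of_forall h hinvF L U hL' hLd' hU' hUd' Xm
  have hD1 : ev D1 h = algebraMap F 𝕂 c := by
    have hmat : D1F.map (Algebra.ofId F 𝕂) = D1 := by
      ext i j
      simp only [D1, D1F, Matrix.map_apply, Matrix.of_apply, apply_ite (Algebra.ofId F 𝕂), map_one,
        map_zero]
    rw [hcdef, show algebraMap F 𝕂 (ev D1F h) = (Algebra.ofId F 𝕂) (ev D1F h) from rfl, map_ev, hmat]
  have hE1 : ev Xm h = (∏ i, a i ^ rowWt e₀ i) * algebraMap F 𝕂 c := by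
    rw [← hinvK, hcorner, hD, ev_rowScale_of_rowWt_eq a D1 h (rowWt e₀) hrow, hD1]
  -- `c ≠ 0`
  have hc : c ≠ 0 := by
    intro hc0
    apply hh0
    apply hinj
    rw [hE1, hc0, map_zero, mul_zero, map_zero]
  -- rows `≥ m` carry no weight
  have hvan : ∀ i : Fin n, m ≤ (i : ℕ) → rowWt e₀ i = 0 := by
    intro i hi
    let a' : Fin n → F := fun i => if (i : ℕ) < m then 1 else 0
    have hsc := ev_rowScale_of_rowWt_eq a' D1F h (rowWt e₀) hrow
    have hmat : (Matrix.of fun i j => a' i * D1F i j) = D1F := by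
      ext i' j
      simp only [Matrix.of_apply, a', D1F]
      by_cases h1 : (i' : ℕ) < m
      · simp [h1]
      · have : ¬ ((i' : ℕ) = (j : ℕ)) := fun h2 => h1 (h2 ▸ j.2)
        simp [h1, this]
    rw [hmat, ← hcdef] at hsc
    have hprod : ∏ i', a' i' ^ rowWt e₀ i' = 1 :=
      mul_right_cancel₀ hc (hsc.symm.trans (one_mul c).symm)
    by_contra hμ
    have hzero : a' i ^ rowWt e₀ i = 0 := by
      simp only [a', if_neg (not_lt.mpr hi)]
      exact zero_pow hμ
    have := Finset.prod_eq_zero (f := fun i' => a' i' ^ rowWt e₀ i') (Finset.mem_univ i) hzero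
    rw [hprod] at this
    exact one_ne_zero this
  -- leading principal minors in `𝕂`
  have hminor : ∀ k (hkn : k ≤ n) (hkm : k ≤ m),
      ev Xm (leadingMinor F n m k) = ∏ i : Fin k, δ (Fin.castLE (hkn.trans hn) i) := by
    intro k hkn hkm
    rw [leadingMinor_of_le hkn hkm, ev_det_submatrix]
    have h1 := submatrix_mul_mul_castLE L Xm U hL' hU' hkn hkm
    have h2 : ((L * Xm * U).submatrix (Fin.castLE hkn) (Fin.castLE hkm)).det =
        (Xm.submatrix (Fin.castLE hkn) (Fin.castLE hkm)).det := by
      rw [h1, det_mul, det_mul, det_corner_eq_one_of_lower L hL' hLd' hkn,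
        det_corner_eq_one_of_upper U hU' hUd' hkm, one_mul, mul_one]
    rw [← h2, hcorner, submatrix_submatrix]
    have e1 : (Fin.castLE hn ∘ Fin.castLE hkn : Fin k → Fin s) = Fin.castLE (hkn.trans hn) :=
      funext fun i => Fin.ext rfl
    have e2 : (Fin.castLE hm ∘ Fin.castLE hkm : Fin k → Fin s) = Fin.castLE (hkn.trans hn) :=
      funext fun i => Fin.ext rfl
    rw [e1, e2, det_corner_diagonal]
  -- bookkeeping with natural indices
  let μ' : ℕ → ℕ := rowWt' e₀
  have hμ'anti : ∀ i, μ' (i + 1) ≤ μ' i := by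
    intro i
    by_cases hi1 : i + 1 < n
    · simp only [μ', rowWt'_of_lt e₀ hi1, rowWt'_of_lt e₀ (Nat.lt_of_succ_lt hi1)]
      exact hanti ⟨i, _⟩ ⟨i + 1, hi1⟩ (Fin.lt_def.mpr (Nat.lt_succ_self i))
    · simp only [μ', rowWt'_of_le e₀ (not_lt.mp hi1)]
      exact Nat.zero_le _
  have hμ'0 : ∀ i, min n m ≤ i → μ' i = 0 := by
    intro i hi
    by_cases hin : i < n
    · simp only [μ', rowWt'_of_lt e₀ hin]
      exact hvan ⟨i, hin⟩ (by simp only; omega)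
    · exact rowWt'_of_le e₀ (not_lt.mp hin)
  let A' : ℕ → 𝕂 := fun i => if h : i < s then δ ⟨i, h⟩ else 1
  have hA'fin : ∀ k (hk : k ≤ s), ∏ i : Fin k, δ (Fin.castLE hk i) = ∏ i ∈ Finset.range k, A' i := by
    intro k hk
    rw [← Fin.prod_univ_eq_prod_range]
    refine Finset.prod_congr rfl fun i _ => ?_
    have hi : (i : ℕ) < s := lt_of_lt_of_le i.2 hk
    simp only [A', dif_pos hi]
    rfl
  set p := min n m with hpdef
  have hpn : p ≤ n := Nat.min_le_left n m
  have hpm : p ≤ m := Nat.min_le_right n m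
  -- `ev Xm h = c · ∏_{i<p} A'_i^{μ'_i}`
  have hE2 : ev Xm h = algebraMap F 𝕂 c * ∏ i ∈ Finset.range p, A' i ^ μ' i := by
    rw [hE1, mul_comm]
    congr 1
    have h1 : ∏ i : Fin n, a i ^ rowWt e₀ i = ∏ i ∈ Finset.range n, A' i ^ μ' i := by
      rw [← Fin.prod_univ_eq_prod_range]
      refine Finset.prod_congr rfl fun i _ => ?_
      have hi : (i : ℕ) < s := lt_of_lt_of_le i.2 hn
      simp only [a, A', μ', dif_pos hi, rowWt'_of_lt e₀ i.2]
      rfl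
    rw [h1]
    symm
    refine Finset.prod_subset (Finset.range_subset_range.mpr hpn) fun i _ hip => ?_
    rw [hμ'0 i (not_lt.mp (by simpa using hip)), pow_zero]
  -- `ev Xm (∏ minors) = ∏_{i<p} A'_i^{μ'_i}`
  have hE3 : ev Xm (∏ k ∈ Finset.range p, leadingMinor F n m (k + 1) ^ (μ' k - μ' (k + 1))) =
      ∏ i ∈ Finset.range p, A' i ^ μ' i := by
    rw [map_prod]
    have h1 : ∀ k ∈ Finset.range p, ev Xm (leadingMinor F n m (k + 1) ^ (μ' k - μ' (k + 1))) =
        (∏ i ∈ Finset.range (k + 1), A' i) ^ (μ' k - μ' (k + 1)) := by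
      intro k hk
      have hk' : k + 1 ≤ p := Finset.mem_range.mp hk
      rw [map_pow, hminor (k + 1) (hk'.trans hpn) (hk'.trans hpm), hA'fin (k + 1) ((hk'.trans hpn).trans hn)]
    rw [Finset.prod_congr rfl h1, prod_pow_sub_telescope A' μ' hμ'anti p]
    refine Finset.prod_congr rfl fun i _ => ?_
    rw [hμ'0 p le_rfl, Nat.sub_zero]
  refine ⟨c, hc, hμ'0, hμ'anti, hinj ?_⟩
  rw [map_mul, ev_C, hE3, ← hE2]

end Identification

/-! ### Step 6: the largest part is `≥ r` -/

/-- Leading principal minors of the test matrix `rectOne t`. [folklore] -/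
theorem det_corner_rectOne {k t : ℕ} (hkn : k ≤ n) (hkm : k ≤ m) :
    ((rectOne F n m t).submatrix (Fin.castLE hkn) (Fin.castLE hkm)).det = if k ≤ t then 1 else 0 := by
  split_ifs with h
  · have : (rectOne F n m t).submatrix (Fin.castLE hkn) (Fin.castLE hkm) = 1 := by
      ext i j
      simp only [rectOne, Matrix.submatrix_apply, Matrix.of_apply, Fin.val_castLE, Matrix.one_apply,
        Fin.ext_iff]
      by_cases hij : (i : ℕ) = (j : ℕ)
      · have : (i : ℕ) < t := lt_of_lt_of_le i.2 h
        simp [hij, hij ▸ this]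
      · simp [hij]
    rw [this, det_one]
  · push Not at h
    refine Matrix.det_eq_zero_of_row_eq_zero ⟨t, h⟩ fun j => ?_
    simp [rectOne]

/-- Evaluation of a leading principal minor at a numerical matrix. [folklore] -/
theorem ev_leadingMinor {k : ℕ} (hkn : k ≤ n) (hkm : k ≤ m) (M : Matrix (Fin n) (Fin m) F) :
    ev M (leadingMinor F n m k) = (M.submatrix (Fin.castLE hkn) (Fin.castLE hkm)).det := by
  rw [leadingMinor_of_le hkn hkm, ev_det_submatrix]

/-- **The width bound `σ₁ ≥ r`** (the role of Cor. 2.26 in the printed proof): if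
`c · ∏_k (det X_{[k+1]})^{e_k}` with `c ≠ 0` vanishes at the rank-`(r-1)` test matrix, some `e_k`
with `k + 1 ≥ r` is nonzero. [cite: AndrewsForbes2022, Cor. 2.26 / Prop. 3.5] -/
theorem exists_part_ge {r p : ℕ} (hr : 0 < r) (hpn : p ≤ n) (hpm : p ≤ m) {c : F} (hc : c ≠ 0)
    (ex : ℕ → ℕ)
    (hv : ev (rectOne F n m (r - 1)) (C c * ∏ k ∈ Finset.range p, leadingMinor F n m (k + 1) ^ ex k) = 0) :
    ∃ k, k < p ∧ r ≤ k + 1 ∧ ex k ≠ 0 := by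
  rw [map_mul, ev_C, Algebra.algebraMap_self, RingHom.id_apply, map_prod] at hv
  rcases mul_eq_zero.mp hv with h | h
  · exact absurd h hc
  · obtain ⟨k, hk, hk0⟩ := Finset.prod_eq_zero_iff.mp h
    have hkp : k + 1 ≤ p := Finset.mem_range.mp hk
    rw [map_pow, ev_leadingMinor (hkp.trans hpn) (hkp.trans hpm), det_corner_rectOne] at hk0
    obtain ⟨h1, h2⟩ := pow_eq_zero_iff'.mp hk0  -- hmm
    refine ⟨k, hkp, ?_, h2⟩
    by_contra hlt
    push Not at hlt
    rw [if_pos (by omega)] at h1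
    exact one_ne_zero h1

/-! ### Step 7: passage to `ε` and the statement -/

section Epsilon

variable {K : Type*} [Field K] [Algebra F K]

/-- The `ε`-weighted substitution `x_{kl} ↦ t^{w(k,l)} x_{kl}` over an extension `K` of `𝔽`, on
coefficients: `coeff_e = ι(coeff_e p) · t^{⟨w,e⟩}`. [cite: AndrewsForbes2022, §3.1 (proof of Prop. 3.5, the map φ)] -/
theorem coeff_ev_weightSubst (w : Fin n × Fin m → ℕ) (t : K) (p : MvPolynomial (Fin n × Fin m) F)
    (e : Fin n × Fin m →₀ ℕ) :
    coeff e (ev (Matrix.of fun (k : Fin n) (l : Fin m) =>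
      (C (t ^ w (k, l)) * X (k, l) : MvPolynomial (Fin n × Fin m) K)) p) =
      algebraMap F K (coeff e p) * t ^ Finsupp.weight w e := by
  classical
  set M : Matrix (Fin n) (Fin m) (MvPolynomial (Fin n × Fin m) K) :=
    Matrix.of fun (k : Fin n) (l : Fin m) => (C (t ^ w (k, l)) * X (k, l) : MvPolynomial (Fin n × Fin m) K)
  have hmon : ∀ (e' : Fin n × Fin m →₀ ℕ) (c : F),
      ev M (monomial e' c) = monomial e' (algebraMap F K c * t ^ Finsupp.weight w e') := by
    intro e' c
    rw [ev_monomial]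
    simp only [M, Matrix.of_apply, mul_pow, Finset.prod_mul_distrib]
    have hX : (∏ ij : Fin n × Fin m, (X ij : MvPolynomial (Fin n × Fin m) K) ^ e' ij) = monomial e' 1 := by
      rw [← MvPolynomial.prod_X_pow_eq_monomial]
      exact (Finset.prod_subset (Finset.subset_univ _) fun x _ hx => by
        rw [Finsupp.notMem_support_iff.mp hx, pow_zero]).symm
    have hC : (∏ ij : Fin n × Fin m, (C (t ^ w ij) : MvPolynomial (Fin n × Fin m) K) ^ e' ij) =
        C (t ^ Finsupp.weight w e') := by
      simp only [← map_pow, ← map_prod, ← pow_mul]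
      rw [Finset.prod_pow_eq_pow_sum, Finsupp.weight_apply, Finsupp.sum_fintype _ _ (by simp)]
      simp only [smul_eq_mul, mul_comm]
    have hXe : (∏ ij : Fin n × Fin m, (X (ij.1, ij.2) : MvPolynomial (Fin n × Fin m) K) ^ e' ij) =
        ∏ ij : Fin n × Fin m, (X ij : MvPolynomial (Fin n × Fin m) K) ^ e' ij := rfl
    have hCe : (∏ ij : Fin n × Fin m, (C (t ^ w (ij.1, ij.2)) : MvPolynomial (Fin n × Fin m) K) ^ e' ij) =
        ∏ ij : Fin n × Fin m, (C (t ^ w ij) : MvPolynomial (Fin n × Fin m) K) ^ e' ij := rfl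
    rw [hXe, hCe, hX, hC, MvPolynomial.algebraMap_apply, ← mul_assoc, ← map_mul, C_mul_monomial,
      mul_one]
  conv_lhs => rw [p.as_sum, map_sum]
  rw [coeff_sum]
  simp only [hmon, coeff_monomial]
  rw [Finset.sum_eq_single e]
  · rw [if_pos rfl]
  · intro e' _ hne
    rw [if_neg hne]
  · intro he
    rw [MvPolynomial.notMem_support_iff.mp he, map_zero, zero_mul, ite_self]

/-- The change of variables of the statement, `x_{ij} ↦ ∑_{kl} A_{ik} B_{lj} t^{w(k,l)} x_{kl}`, is
the `ε`-weighted substitution applied to the translate `f(AXB)`. [folklore] -/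
theorem aeval_sum_eq_ev_transl (w : Fin n × Fin m → ℕ) (t : K) (A : Matrix (Fin n) (Fin n) F)
    (B : Matrix (Fin m) (Fin m) F) (p : MvPolynomial (Fin n × Fin m) F) :
    MvPolynomial.aeval (fun ij : Fin n × Fin m => ∑ kl : Fin n × Fin m,
      C (algebraMap F K (A ij.1 kl.1 * B kl.2 ij.2) * t ^ w kl) * (X kl : MvPolynomial (Fin n × Fin m) K)) p =
      ev (Matrix.of fun (k : Fin n) (l : Fin m) =>
        (C (t ^ w (k, l)) * X (k, l) : MvPolynomial (Fin n × Fin m) K)) (transl A B p) := by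
  set θ := ev (F := F) (Matrix.of fun (k : Fin n) (l : Fin m) =>
    (C (t ^ w (k, l)) * X (k, l) : MvPolynomial (Fin n × Fin m) K)) with hθ
  rw [← AlgHom.comp_apply]
  refine DFunLike.congr_fun ?_ p
  refine MvPolynomial.algHom_ext fun ij => ?_
  obtain ⟨i, j⟩ := ij
  rw [aeval_X, AlgHom.comp_apply, transl_apply, ev_X]
  simp only [Matrix.mul_apply, Matrix.map_apply, mvPolynomialX_apply, map_sum, map_mul, Finset.sum_mul]
  rw [Fintype.sum_prod_type, Finset.sum_comm]
  refine Finset.sum_congr rfl fun l _ => Finset.sum_congr rfl fun k _ => ?_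
  have hC : ∀ x : F, θ (C x) = C (algebraMap F K x) := fun x => by
    rw [hθ, ev_C, MvPolynomial.algebraMap_apply]
  rw [hC, hC, hθ, ev_X]
  simp only [Matrix.of_apply]
  ring

open scoped RatFunc in
/-- `ι(a) · ε^j = O(ε^k)` for `k ≤ j` (the scoped instance `RatFunc.liftAlgebra` provides the
algebra map `𝔽(ε) → 𝔽((ε))` underlying the coercion in `IsBigOEps`). [folklore] -/
theorem isBigOEps_algebraMap_mul_X_pow (a : F) {j : ℕ} {k : ℤ} (hkj : k ≤ j) :
    IsBigOEps F k (algebraMap F (RatFunc F) a * RatFunc.X ^ j) := by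
  intro i hi
  have hcoe : ((algebraMap F (RatFunc F) a * RatFunc.X ^ j : RatFunc F) : LaurentSeries F) =
      HahnSeries.single (j : ℤ) a := by
    rw [map_mul, map_pow, RatFunc.coe_X, IsScalarTower.algebraMap_apply F (Polynomial F) (RatFunc F),
      Polynomial.algebraMap_eq,
      ← IsScalarTower.algebraMap_apply (Polynomial F) (RatFunc F) (LaurentSeries F),
      Polynomial.algebraMap_hahnSeries_apply, Polynomial.coe_C, HahnSeries.ofPowerSeries_C,
      HahnSeries.C_apply, HahnSeries.single_pow, HahnSeries.single_mul_single]
    simp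
  rw [hcoe, HahnSeries.coeff_single_of_ne]
  omega

end Epsilon

end AndrewsForbes

open MvPolynomial Matrix AndrewsForbes in
/-- **Andrews–Forbes 2022, Proposition 3.5** — discharge of the named fact
`AndrewsForbes2022_prop_3_5`: for `𝔽` of characteristic zero, `1 ≤ r ≤ min(n, m)` and a nonzero
`f ∈ I^det_{n,m,r}` there are an invertible change of the `nm` variables over `𝔽(ε)`, `q ∈ ℤ`,
`α ≠ 0` and a partition `σ` with `σ₁ ≥ r` such that `f(ℓ(X)) = ε^q α (K_σ | K_σ)(X) + O(ε^{q+1})`.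
Proof: Steps 1–7 of the module docstring (highest-weight replacement of the straightening
argument; the change of variables is `x_{ij} ↦ ∑ A_{ik} B_{lj} ε^{b^k + b^{n+l}} x_{kl}` for a suitable
`(A, B) ∈ GL_n(𝔽) × GL_m(𝔽)`, as in the printed proof `X ↦ M X N` followed by
`x_{ij} ↦ y^{(D+1)^i} z^{(D+1)^j} x_{ij}` and `y, z ↦ ε^d`). [cite: AndrewsForbes2022, Prop. 3.5] -/
theorem AndrewsForbes2022_prop_3_5_holds : AndrewsForbes2022_prop_3_5 := by
  intro F _ _ n m r hr hrnm f hf hf0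
  classical
  obtain ⟨q, A, B, e₀, hA, hB, he₀, hw₀, hmin⟩ := exists_min_weight (f.totalDegree + 2) hf0
  obtain ⟨c, hc, hμ0, hμanti, hh⟩ :=
    init_eq_C_mul_prod (b := f.totalDegree + 2) (by omega) le_rfl hmin hA hB he₀ hw₀
  have hpn : min n m ≤ n := Nat.min_le_left n m
  have hpm : min n m ≤ m := Nat.min_le_right n m
  have hK : kBideterminant F n m (∑ k ∈ Finset.range (min n m),
      Multiset.replicate (rowWt' e₀ k - rowWt' e₀ (k + 1)) (k + 1)) =
      ∏ k ∈ Finset.range (min n m), leadingMinor F n m (k + 1) ^ (rowWt' e₀ k - rowWt' e₀ (k + 1)) :=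
    kBideterminant_sum_replicate (fun k => rowWt' e₀ k - rowWt' e₀ (k + 1)) (min n m)
  -- the change of variables `x_{ij} ↦ ∑_{kl} A_{ik} B_{lj} ε^{w(k,l)} x_{kl}` is invertible
  have hunit : IsUnit (Matrix.of fun (ij kl : Fin n × Fin m) =>
      algebraMap F (RatFunc F) (A ij.1 kl.1 * B kl.2 ij.2) *
        (RatFunc.X : RatFunc F) ^ dwt n m (f.totalDegree + 2) kl) := by
    have hcM : (Matrix.of fun (ij kl : Fin n × Fin m) =>
        algebraMap F (RatFunc F) (A ij.1 kl.1 * B kl.2 ij.2) *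
          (RatFunc.X : RatFunc F) ^ dwt n m (f.totalDegree + 2) kl) =
        Matrix.kroneckerMap (· * ·) (A.map (algebraMap F (RatFunc F)))
            ((B.transpose).map (algebraMap F (RatFunc F))) *
          diagonal fun kl : Fin n × Fin m => (RatFunc.X : RatFunc F) ^ dwt n m (f.totalDegree + 2) kl := by
      ext ⟨i, j⟩ ⟨k, l⟩
      simp [Matrix.mul_diagonal, Matrix.kroneckerMap_apply, map_mul]
    rw [hcM]
    refine IsUnit.mul ?_ ?_
    · rw [Matrix.isUnit_iff_isUnit_det, Matrix.det_kronecker, isUnit_iff_ne_zero]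
      refine mul_ne_zero (pow_ne_zero _ ?_) (pow_ne_zero _ ?_)
      · rw [← RingHom.mapMatrix_apply, ← RingHom.map_det, map_ne_zero]
        exact hA.ne_zero
      · rw [← RingHom.mapMatrix_apply, ← RingHom.map_det, det_transpose, map_ne_zero]
        exact hB.ne_zero
    · rw [Matrix.isUnit_diagonal]
      exact Pi.isUnit_iff.mpr fun kl => isUnit_iff_ne_zero.mpr (pow_ne_zero _ RatFunc.X_ne_zero)
  refine ⟨_, (q : ℤ), c, ∑ k ∈ Finset.range (min n m),
    Multiset.replicate (rowWt' e₀ k - rowWt' e₀ (k + 1)) (k + 1), hunit, hc, ?_, ?_, ?_⟩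
  · -- `σ₁ ≥ r`: the initial form vanishes at the rank-`(r-1)` test matrix
    have hv : ev (rectOne F n m (r - 1)) (C c * ∏ k ∈ Finset.range (min n m),
        leadingMinor F n m (k + 1) ^ (rowWt' e₀ k - rowWt' e₀ (k + 1))) = 0 := by
      rw [← hh]
      have hmem := init_mem_vanishIdeal (A := A) (B := B) (b := f.totalDegree + 2) (q := q)
        (Nat.sub_lt hr Nat.one_pos) hf
      have := (mem_vanishIdeal_iff.mp hmem) 1 1
      rwa [Matrix.one_mul, Matrix.mul_one] at this
    obtain ⟨k, hkp, hrk, hk0⟩ := exists_part_ge hr hpn hpm hc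
      (fun k => rowWt' e₀ k - rowWt' e₀ (k + 1)) hv
    have hmemσ : k + 1 ∈ ∑ k ∈ Finset.range (min n m),
        Multiset.replicate (rowWt' e₀ k - rowWt' e₀ (k + 1)) (k + 1) :=
      Multiset.mem_sum.mpr ⟨k, Finset.mem_range.mpr hkp, Multiset.mem_replicate.mpr ⟨hk0, rfl⟩⟩
    exact hrk.trans (Multiset.le_sup hmemσ)
  · -- all parts lie in `[1, min n m]`
    intro s' hs'
    obtain ⟨k, hk, hks⟩ := Multiset.mem_sum.mp hs'
    obtain ⟨_, rfl⟩ := Multiset.mem_replicate.mp hks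
    exact ⟨Nat.succ_pos k, Finset.mem_range.mp hk⟩
  · -- the `ε`-expansion, coefficient by coefficient
    intro e
    simp only [Matrix.of_apply]
    rw [aeval_sum_eq_ev_transl, coeff_sub, coeff_ev_weightSubst, coeff_C_mul, coeff_map, hK,
      zpow_natCast]
    have hhe := congrArg (coeff e) hh
    rw [coeff_C_mul, coeff_coeff_twist] at hhe
    by_cases hwe : Finsupp.weight (dwt n m (f.totalDegree + 2)) e = q
    · -- the leading coefficient: exact cancellation
      rw [if_pos hwe] at hhe
      rw [hhe, hwe, map_mul]
      convert isBigOEps_zero (F := F) ((q : ℤ) + 1) using 2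
      ring
    · -- all other coefficients are `O(ε^{q+1})`
      rw [if_neg hwe] at hhe
      have hPi : coeff e (∏ k ∈ Finset.range (min n m),
          leadingMinor F n m (k + 1) ^ (rowWt' e₀ k - rowWt' e₀ (k + 1))) = 0 := by
        rcases mul_eq_zero.mp hhe.symm with h | h
        · exact absurd h hc
        · exact h
      rw [hPi, map_zero, mul_zero, sub_zero]
      by_cases hsupp : e ∈ (transl A B f).support
      · have hq := hmin A B hA hB e hsupp
        have hlt : q < Finsupp.weight (dwt n m (f.totalDegree + 2)) e := lt_of_le_of_ne hq (Ne.symm hwe)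
        exact isBigOEps_algebraMap_mul_X_pow _ (by exact_mod_cast hlt)
      · rw [MvPolynomial.notMem_support_iff.mp hsupp, map_zero, zero_mul]
        exact isBigOEps_zero _

end Literature.Computability.AlgebraicComplexity
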